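import Summits.QuantumFields.YangMills.Theorems.BalabanUVNodesN09RegularOnOfLoopSmallChi29Local
import Literature.MathematicalPhysics.QuantumFieldTheory.Balaban1983to89.Node00.SmallFieldChi29SelOfRecord

/-!
# NODE N09 [B12] · ROAD B FOR AN ARBITRARY CRITICAL LETTER: the g5 junction and the g6 localised door with the minimiser selection `W ↦ V^{(k)}(W)` a PARAMETER —
# one proof serving the bare-choice record (`critCfgOfRecord`), node00-def-K0c∕dag-n09-w4's OFFER (`critCfgSelOfRecord`) and any future selection of record

Cell `pub-ymgap` (YM-PLAN Track A), DAG node N09 [Balaban1987RG1] (= [I]); width seat `pub-ymgap-dag-n09-w3` g6, FILE 3; count-neutral helper keyed to K1⁹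
`StabilityBRunRowsAtRecordR13SepCoPHV` = stmt-QuantumFields-27364 (`--kind proof --supports … --as helper`).

WHY.  g5's `…N09RegularOfLoopSmallChi29.regular_of_loopSmall_chi29` and g6's `…N09RegularOnOfLoopSmallChi29Local.regularOn_of_loopSmall_chi29_local` cut the density at the
(2.9) thresholds of the BARE-CHOICE critical configuration `critCfgOfRecord ν K k` (node00-def-B's `Uk`, a `Classical.choose` selection with the documented junk corner); their
continuity clause then asks `hcrit` of THAT selection, which no theorem supplies (this seat's g0 finding: (H-U) ∕ (M1) ∕ HERED ∕ `hcrit` are properties of ONE object, the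
selection of record — cured only by a record edition, e.g. the measurable, (181)-covariant offer `UkSel` ∕ `critCfgSelOfRecord` of `Node00.SmallFieldChi29SelOfRecord`, for which
dag-n09-w1 g6 PROVES `hcrit` on the domains from [B11] Thm 1).  Nothing in the two proofs reads the selection except through the letter `W ↦ V^{(k)}(W)(b)`; THIS FILE makes that
letter a PARAMETER `crit : (coarse fields) → (fine fields)`: the (2.9)-type exemption becomes «`dist1 (crit(Ū U)(b)⁻¹·U(b)) ≠ ε₁` at every non-distinguished `b`», the
determinant family of `…N09Chi29ThresholdsNowhereFibreFlat` is fed the letter `(crit(V_y)(b))⁻¹` (it was always generic), and both theorems hold VERBATIM for every `crit`.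
The bare edition is the instance `crit := critCfgOfRecord ν K k` (`fluctDevOfRecord_apply`, `rfl`); the Sel edition `crit := critCfgSelOfRecord ν K k` is §3.

WHAT IS PROVED (theorems only; 0 def, 0 sorry; axioms standard).
§1 ★★★ `regular_of_loopSmall_thresholds` — g5's GLOBAL junction for an arbitrary letter `crit`.
§2 ★★★ `regularOn_of_loopSmall_thresholds_local` — g6's LOCAL door for an arbitrary letter `crit` (same bump ∕ cut-off ∕ fibre-locality argument, by name).
§3 ★★ `regularOn_of_loopSmall_chi29Sel_local`, ★ `domAlt_subset_regSetOfRecord_of_loopSmall_chi29Sel_local` — the Sel edition (exemption read through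
   `Node00.fluctDevSelOfRecord`), i.e. ROAD B's `hreg` SHAPE for densities cut at the OFFER's (2.9) thresholds, whose `hcrit` IS dag-n09-w1 g6's theorem on the domains;
   the bare edition is g6 FILE 1's `regularOn_of_loopSmall_chi29_local` itself (`crit := critCfgOfRecord ν K k`, definitionally — not restated).

HONEST SCOPE ∕ FRAMING.  LOCATED, count-neutral generalisation BY NAME of this seat's g5∕g6 theorems (dag-n09-w2 g4's sharp engine, p631718's determinant family, p607548,
dag-n09-w4's averaging continuity, K0e's `regSet` faces); NO record edition is made or proposed here (the Sel objects are node00-def-K0c∕dag-n09-w4 g2's OFFER, untouched);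
the support ∕ continuity clauses, (I19), measurability stay DISPLAYED; NOTHING of Bałaban's asserted; `hreg`∕(F3)∕`contTOn` NOT discharged; N09 NOT discharged; conjunct 1
(Lemma 4) ∕ FLAG №7 untouched; K0⁷ ∕ K1⁹ ∕ K2⁹ ∕ K3⁸ NOT closed; counts unmoved (typed 28∕28 · discharged 5∕28); one finite four-torus programme at fixed `ε = L^{−K}` per
run — R4 closes the conditional rung `BalabanLadder.UV` only; NOT ℝ⁴ ∕ infinite volume ∕ OS; the Yang–Mills mass gap (Clay) is NOT proved by any of this.
-/

noncomputable section

open scoped Matrix.Norms.L2Operator Topology ENNReal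
open Filter Set Function MeasureTheory

namespace Summit.QuantumFields.YangMills.BalabanUVNodes.N09RegularOnOfLoopSmallThresholdsAnyCrit

open Literature.MathematicalPhysics.QuantumFieldTheory.Balaban1983to89
open Literature.MathematicalPhysics.QuantumFieldTheory.Balaban1983to89.HaarExponentialChart
open Literature.MathematicalPhysics.QuantumFieldTheory.Balaban1983to89.HaarExponentialChart.IsChartRep
open Literature.MathematicalPhysics.QuantumFieldTheory.Balaban1983to89.BlockAveraging (Small Idx avgFun loopHol)
open Literature.MathematicalPhysics.QuantumFieldTheory.Balaban1983to89.BlockAveragingHaarAC (centralBond)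
open Literature.MathematicalPhysics.QuantumFieldTheory.Balaban1983to89.ExpMeanLog (expMeanLogSU deltaSU)
open Literature.MathematicalPhysics.QuantumFieldTheory.Balaban1983to89.Node00
open Literature.MathematicalPhysics.QuantumLattice (fundamentalRep fundamentalRep_apply)
open Summit.QuantumFields.YangMills.BalabanUVNodes.N09ChartReadAveragingSmooth (continuousAt_avgFun_of_small)
open Summit.QuantumFields.YangMills.BalabanUVNodes.N09ContTransportOfLoopSmallSharp (regular_of_loopSmall_sharp)
open Summit.QuantumFields.YangMills.BalabanUVNodes.N09Chi29ThresholdsNowhereFibreFlat (analyticOnNhd_detFamily exists_nhds_nowhereFibreFlat_detFamily)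
open Summit.QuantumFields.YangMills.BalabanUVNodes.N09RegularOfLoopSmallChi29 (coarse_chartInverse_eq_avg inversionWindow_mem_nhds_zero)
open Summit.QuantumFields.YangMills.BalabanUVNodes.N09RegularOnOfLoopSmallChi29Local (measurable_cutoff cutoff_nonneg cutoff_le cutoff_eq_zero_of_not_mem
  continuousAt_cutoff subset_regSetOfRecord_of_eqOn_preimage hasContTransportOn_of_subset_regSetOfRecord)

variable {F : T4Continuum.T4Family} {N : ℕ} [NeZero N] {K k : ℕ}

/-! ## §1 g5's junction for an arbitrary critical letter -/

/-- ★★★ **ROAD B CLOSED BY NAME FOR DENSITIES CUT AT THE THRESHOLDS OF AN ARBITRARY CRITICAL LETTER.**  For `k < K`, `ε₁ ≠ 0`, the loop α-guard in the standing range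
(`α ≤ 1∕24`, `α < δ_N`, `157·α < L^{1−d}`), ANY map `crit : (coarse fields) → (fine fields)` (the bare `critCfgOfRecord ν K k`, the offer `critCfgSelOfRecord ν K k`, …), and every
measurable `ρ ≥ 0`, bounded, zero off a closed `K₀` inside the guard and CONTINUOUS AT EVERY `U ∈ K₀` AT WHICH NO NON-DISTINGUISHED THRESHOLD OF `crit` IS ACTIVE
(`∀ b, (∀ c, β(c) ≠ b) → dist1 (crit(Ū U)(b)⁻¹·U(b)) ≠ ε₁`): every open set of coarse fields lies in `regSetOfRecord F N K k ρ` with `HasContTransportOn`, and `TcanOfRecord F N K k ρ`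
is continuous.  g5's proof VERBATIM with the letter a parameter: dag-n09-w2's `regular_of_loopSmall_sharp`, the determinant family `Γ U₀ b y A = normSq det((ε₁²−2)·1 + W + Wᴴ)`,
`W = ↑crit(V_y)(b)⁻¹·↑Θ(A b)·↑U₀(b)` (fibrewise analytic, nowhere fibre-flat — NO transversality), the inversion window of g5 §1, and p607548's level equation for the link.
[cite: Balaban1987RG1, (0.13) p.254, p.259, (2.9) p.266 and (2.10) p.267] [cite: Mityagin2015, Proposition 1] [cite: Balaban1985Averaging, (19) p.21] -/
theorem regular_of_loopSmall_thresholds (crit : GaugeField (F.P K) (k + 1) (SU N) → GaugeField (F.P K) k (SU N)) (hk : k < K) {α : ℝ} (hα24 : α ≤ 1 / 24)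
    (hαδ : α < deltaSU (Fin N)) (hαL : 157 * α < (((F.P K).L : ℝ) ^ ((F.P K).d - 1))⁻¹) {ε₁ : ℝ} (hε : ε₁ ≠ 0) {ρ : Density (F.P K) k (SU N)}
    (hρm : Measurable ρ) (hρ0 : ∀ U, 0 ≤ ρ U) (hρC : ∃ C₀ : ℝ, ∀ U, ρ U ≤ C₀)
    {K₀ : Set (GaugeField (F.P K) k (SU N))} (hK₀ : IsClosed K₀) (hρK : ∀ U, U ∉ K₀ → ρ U = 0)
    (hK₀α : ∀ U ∈ K₀, ∀ c i, dist1 (loopHol U c i) ≤ α)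
    (hρc : ∀ U ∈ K₀, (∀ b : PBond (F.P K) k, (∀ c, centralBond c ≠ b) → dist1 ((crit ((avOfRecord F N K k).avg U) b)⁻¹ * U b) ≠ ε₁) → ContinuousAt ρ U) :
    (∀ U : Set (PBond (F.P K) (k + 1) → SU N), IsOpen U → U ⊆ regSetOfRecord F N K k ρ ∧ HasContTransportOn F N K k ρ U) ∧
      Continuous (TcanOfRecord F N K k ρ) := by
  classical
  have hj : k + 1 ≤ (F.P K).m + (F.P K).K := by simp only [T4Continuum.T4Family.P_K]; omega
  set Θ := (isChartRep_specialUnitaryGroup (n := Fin N)).expChart with hΘdef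
  set Λ := (isChartRep_specialUnitaryGroup (n := Fin N)).logChart with hΛdef
  set hcrit : GaugeField (F.P K) k (SU N) → PBond (F.P K) k → (PBond (F.P K) (k + 1) → (specialUnitaryLogChart (Fin N)).lie) → SU N :=
    fun U₀ b y => (crit (fun c => Θ (y c) * (avOfRecord F N K k).avg U₀ c) b)⁻¹ with hhcrit
  set Γ : GaugeField (F.P K) k (SU N) → {b : PBond (F.P K) k // ∀ c, centralBond c ≠ b} →
      (PBond (F.P K) (k + 1) → (specialUnitaryLogChart (Fin N)).lie) → (PBond (F.P K) k → (specialUnitaryLogChart (Fin N)).lie) → ℝ :=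
    fun U₀ i y A => Complex.normSq ((((ε₁ ^ 2 - 2 : ℝ) : ℂ)) • (1 : Matrix (Fin N) (Fin N) ℂ) +
      ((hcrit U₀ i.1 y : Matrix (Fin N) (Fin N) ℂ) * (Θ (A i.1) : Matrix (Fin N) (Fin N) ℂ) * (U₀ i.1 : Matrix (Fin N) (Fin N) ℂ)) +
      ((hcrit U₀ i.1 y : Matrix (Fin N) (Fin N) ℂ) * (Θ (A i.1) : Matrix (Fin N) (Fin N) ℂ) * (U₀ i.1 : Matrix (Fin N) (Fin N) ℂ)).conjTranspose).det with hΓdef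
  have hsmall : ∀ U₀ ∈ K₀, ∀ c, Small (expMeanLogSU (n := Fin N)) U₀ c := fun U₀ hU₀ c i => lt_of_le_of_lt (hK₀α U₀ hU₀ c i) hαδ
  have hW5 : ∀ U₀ ∈ K₀, ∃ O₁ : Set (PBond (F.P K) k → (specialUnitaryLogChart (Fin N)).lie), IsOpen O₁ ∧
      (0 : PBond (F.P K) k → (specialUnitaryLogChart (Fin N)).lie) ∈ O₁ ∧
      (∀ A ∈ O₁, ∀ b, ‖A b‖ < chartRadius (specialUnitaryLogChart (Fin N))) ∧
      ∀ A ∈ O₁, ∀ i, Γ U₀ i ((fun A : PBond (F.P K) k → (specialUnitaryLogChart (Fin N)).lie =>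
          (fun (V : PBond (F.P K) (k + 1) → SU N) (c : PBond (F.P K) (k + 1)) => Λ (V c * ((avOfRecord F N K k).avg U₀ c)⁻¹))
            ((avOfRecord F N K k).avg (fun b => Θ (A b) * U₀ b))) A) A = 0 →
        ∃ᶠ A' in 𝓝[(fun A : PBond (F.P K) k → (specialUnitaryLogChart (Fin N)).lie =>
            (fun (V : PBond (F.P K) (k + 1) → SU N) (c : PBond (F.P K) (k + 1)) => Λ (V c * ((avOfRecord F N K k).avg U₀ c)⁻¹))
              ((avOfRecord F N K k).avg (fun b => Θ (A b) * U₀ b))) ⁻¹'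
            {(fun A : PBond (F.P K) k → (specialUnitaryLogChart (Fin N)).lie =>
              (fun (V : PBond (F.P K) (k + 1) → SU N) (c : PBond (F.P K) (k + 1)) => Λ (V c * ((avOfRecord F N K k).avg U₀ c)⁻¹))
                ((avOfRecord F N K k).avg (fun b => Θ (A b) * U₀ b))) A}] A,
          Γ U₀ i ((fun A : PBond (F.P K) k → (specialUnitaryLogChart (Fin N)).lie =>
            (fun (V : PBond (F.P K) (k + 1) → SU N) (c : PBond (F.P K) (k + 1)) => Λ (V c * ((avOfRecord F N K k).avg U₀ c)⁻¹))
              ((avOfRecord F N K k).avg (fun b => Θ (A b) * U₀ b))) A) A' ≠ 0 :=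
    fun U₀ hU₀ => exists_nhds_nowhereFibreFlat_detFamily (P := F.P K) (j := k) U₀ (hcrit U₀) ε₁ hj (hK₀α U₀ hU₀) hα24 hαδ hαL hε
      rfl (fun _ _ _ => rfl)
  choose! O₁ hO₁o h0O₁ hO₁box hO₁nf using hW5
  set Winv : GaugeField (F.P K) k (SU N) → Set (PBond (F.P K) k → (specialUnitaryLogChart (Fin N)).lie) := fun U₀ =>
    interior {A | ∀ c, ‖(((avOfRecord F N K k).avg (fun b => Θ (A b) * U₀ b) c * ((avOfRecord F N K k).avg U₀ c)⁻¹ : SU N) :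
      Matrix (Fin N) (Fin N) ℂ) - 1‖ < innerRadius (specialUnitaryLogChart (Fin N))} with hWinv
  refine regular_of_loopSmall_sharp hk hα24 hαδ hαL hρm hρ0 hρC
    (fun U => ∀ b : PBond (F.P K) k, (∀ c, centralBond c ≠ b) → dist1 ((crit ((avOfRecord F N K k).avg U) b)⁻¹ * U b) ≠ ε₁) hK₀ hρK hρc hK₀α
    Γ (fun U₀ => O₁ U₀ ∩ Winv U₀) (fun U₀ hU₀ => (hO₁o U₀ hU₀).inter isOpen_interior)
    (fun U₀ hU₀ => ⟨h0O₁ U₀ hU₀, mem_interior_iff_mem_nhds.2 (inversionWindow_mem_nhds_zero U₀ (hsmall U₀ hU₀))⟩)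
    (fun U₀ hU₀ i y => (analyticOnNhd_detFamily (P := F.P K) (j := k) U₀ (hcrit U₀) ε₁ i.1 y).mono (subset_univ _))
    (fun U₀ hU₀ A hA i => hO₁nf U₀ hU₀ A hA.1 i) ?_
  -- `hQ`: off the zero sets of the determinant family no non-distinguished threshold of `crit` is active at `Θ^B(A)·U₀`
  intro U₀ hU₀ A hA hne b hb hdev
  have hwin := interior_subset hA.2
  have hV : (fun c => Θ (Λ ((avOfRecord F N K k).avg (fun b => Θ (A b) * U₀ b) c * ((avOfRecord F N K k).avg U₀ c)⁻¹)) *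
      (avOfRecord F N K k).avg U₀ c) = (avOfRecord F N K k).avg (fun b => Θ (A b) * U₀ b) :=
    coarse_chartInverse_eq_avg U₀ A hwin
  have hW : dist1 ((crit ((avOfRecord F N K k).avg (fun b => Θ (A b) * U₀ b)) b)⁻¹ * (fun b => Θ (A b) * U₀ b) b) =
      ‖(hcrit U₀ b ((fun A : PBond (F.P K) k → (specialUnitaryLogChart (Fin N)).lie =>
          (fun (V : PBond (F.P K) (k + 1) → SU N) (c : PBond (F.P K) (k + 1)) => Λ (V c * ((avOfRecord F N K k).avg U₀ c)⁻¹))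
            ((avOfRecord F N K k).avg (fun b => Θ (A b) * U₀ b))) A) : Matrix (Fin N) (Fin N) ℂ) *
        (Θ (A b) : Matrix (Fin N) (Fin N) ℂ) * (U₀ b : Matrix (Fin N) (Fin N) ℂ) - 1‖ := by
    show ‖(((crit ((avOfRecord F N K k).avg (fun b => Θ (A b) * U₀ b)) b)⁻¹ * (Θ (A b) * U₀ b) : SU N) :
        Matrix (Fin N) (Fin N) ℂ) - 1‖ = _
    rw [Submonoid.coe_mul, Submonoid.coe_mul, ← mul_assoc]
    simp only [hhcrit, hV]
  have hΓ0 : Γ U₀ ⟨b, hb⟩ ((fun A : PBond (F.P K) k → (specialUnitaryLogChart (Fin N)).lie =>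
      (fun (V : PBond (F.P K) (k + 1) → SU N) (c : PBond (F.P K) (k + 1)) => Λ (V c * ((avOfRecord F N K k).avg U₀ c)⁻¹))
        ((avOfRecord F N K k).avg (fun b => Θ (A b) * U₀ b))) A) A = 0 := by
    have hunit : (hcrit U₀ b ((fun A : PBond (F.P K) k → (specialUnitaryLogChart (Fin N)).lie =>
        (fun (V : PBond (F.P K) (k + 1) → SU N) (c : PBond (F.P K) (k + 1)) => Λ (V c * ((avOfRecord F N K k).avg U₀ c)⁻¹))
          ((avOfRecord F N K k).avg (fun b => Θ (A b) * U₀ b))) A) : Matrix (Fin N) (Fin N) ℂ) *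
        (Θ (A b) : Matrix (Fin N) (Fin N) ℂ) * (U₀ b : Matrix (Fin N) (Fin N) ℂ) ∈ Matrix.unitaryGroup (Fin N) ℂ := by
      rw [← Submonoid.coe_mul, ← Submonoid.coe_mul]
      exact (Matrix.mem_specialUnitaryGroup_iff.mp (SetLike.coe_mem _)).1
    have hdet := HaarDist1LevelHypersurface.det_level_eq_zero_of_norm_sub_one_eq hunit (hW.symm.trans hdev)
    show Complex.normSq _ = 0
    rw [Complex.normSq_eq_zero]
    exact hdet
  exact hne ⟨b, hb⟩ hΓ0

/-! ## §2 g6's localised door for an arbitrary critical letter -/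

/-- ★★★ **ROAD B LOCALISED OVER THE COARSE DOMAIN, FOR AN ARBITRARY CRITICAL LETTER.**  As `…N09RegularOnOfLoopSmallChi29Local.regularOn_of_loopSmall_chi29_local`, with the
exemption read through ANY `crit : (coarse fields) → (fine fields)`: `k < K`, `ε₁ ≠ 0`, the loop α-guard in the standing range, `D` OPEN, `K₀` CLOSED inside the guard, `ρ ≥ 0`
measurable and integrable, `ρ ≤ C₀` ON `K₀`, the LOCAL support clause `Ū U ∈ D → ρ U ≠ 0 → U ∈ interior K₀`, the LOCAL continuity clause
`∀ U ∈ K₀, Ū U ∈ D → (∀ b, (∀ c, β(c) ≠ b) → dist1 (crit(Ū U)(b)⁻¹·U(b)) ≠ ε₁) → ContinuousAt ρ U` ⊢ `D ⊆ regSetOfRecord F N K k ρ ∧ HasContTransportOn F N K k ρ D` — g6's bump ∕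
cut-off ∕ fibre-locality argument BY NAME over §1. [cite: Balaban1987RG1, (0.13) p.254, p.259, (2.9) p.266 and (2.10) p.267] [cite: Balaban1985Averaging, (10) p.19 and (19) p.21] -/
theorem regularOn_of_loopSmall_thresholds_local (crit : GaugeField (F.P K) (k + 1) (SU N) → GaugeField (F.P K) k (SU N)) (hk : k < K) {α : ℝ}
    (hα24 : α ≤ 1 / 24) (hαδ : α < deltaSU (Fin N)) (hαL : 157 * α < (((F.P K).L : ℝ) ^ ((F.P K).d - 1))⁻¹) {ε₁ : ℝ} (hε : ε₁ ≠ 0)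
    {ρ : Density (F.P K) k (SU N)} (hρm : Measurable ρ) (hρi : Integrable ρ (fieldMeasure (F.P K) k (SU N))) (hρ0 : ∀ U, 0 ≤ ρ U)
    {D : Set (GaugeField (F.P K) (k + 1) (SU N))} (hD : IsOpen D)
    {K₀ : Set (GaugeField (F.P K) k (SU N))} (hK₀ : IsClosed K₀) (hK₀α : ∀ U ∈ K₀, ∀ c i, dist1 (loopHol U c i) ≤ α)
    (hρC : ∃ C₀ : ℝ, ∀ U ∈ K₀, ρ U ≤ C₀)
    (hρK : ∀ U, (avOfRecord F N K k).avg U ∈ D → ρ U ≠ 0 → U ∈ interior K₀)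
    (hρc : ∀ U ∈ K₀, (avOfRecord F N K k).avg U ∈ D →
      (∀ b : PBond (F.P K) k, (∀ c, centralBond c ≠ b) → dist1 ((crit ((avOfRecord F N K k).avg U) b)⁻¹ * U b) ≠ ε₁) → ContinuousAt ρ U) :
    D ⊆ regSetOfRecord F N K k ρ ∧ HasContTransportOn F N K k ρ D := by
  classical
  obtain ⟨C₀, hC₀⟩ := hρC
  have hsmall : ∀ U ∈ K₀, ∀ c, Small (expMeanLogSU (n := Fin N)) U c := fun U hU c i => lt_of_le_of_lt (hK₀α U hU c i) hαδ
  have hsub : D ⊆ regSetOfRecord F N K k ρ := by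
    intro V₀ hV₀
    haveI : CompletelyRegularSpace (GaugeField (F.P K) (k + 1) (SU N)) :=
      inferInstanceAs (CompletelyRegularSpace (PBond (F.P K) (k + 1) → SU N))
    haveI : BorelSpace (GaugeField (F.P K) (k + 1) (SU N)) := inferInstanceAs (BorelSpace (PBond (F.P K) (k + 1) → SU N))
    obtain ⟨f, hfc, hf0, hf1⟩ := CompletelyRegularSpace.completely_regular (V₀ : GaugeField (F.P K) (k + 1) (SU N)) Dᶜ
      hD.isClosed_compl (fun h => h hV₀)
    have hfc' : Continuous fun V : GaugeField (F.P K) (k + 1) (SU N) => (f V : ℝ) := continuous_subtype_val.comp hfc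
    set φ : GaugeField (F.P K) (k + 1) (SU N) → ℝ := fun V => min 1 (max 0 (2 - 3 * (f V : ℝ))) with hφ
    have hφc : Continuous φ := continuous_const.min (continuous_const.max (continuous_const.sub (continuous_const.mul hfc')))
    have hφ0 : ∀ V, 0 ≤ φ V := fun V => le_min zero_le_one (le_max_left _ _)
    have hφ1 : ∀ V, φ V ≤ 1 := fun V => min_le_left _ _
    have hφD : ∀ V, V ∉ D → φ V = 0 := by
      intro V hV
      have h1 : (f V : ℝ) = 1 := by rw [show f V = 1 from hf1 hV]; exact Set.Icc.coe_one
      show min 1 (max 0 (2 - 3 * (f V : ℝ))) = 0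
      rw [h1, show (2 : ℝ) - 3 * 1 = -1 by norm_num, max_eq_left (by norm_num : (-1 : ℝ) ≤ 0)]
      exact min_eq_right zero_le_one
    set U₁ : Set (GaugeField (F.P K) (k + 1) (SU N)) := {V | (f V : ℝ) < 1 / 3} with hU₁
    have hU₁o : IsOpen U₁ := isOpen_lt hfc' continuous_const
    have hV₀U₁ : V₀ ∈ U₁ := by
      show (f V₀ : ℝ) < 1 / 3
      rw [hf0, Set.Icc.coe_zero]; norm_num
    have hφU₁ : ∀ V ∈ U₁, φ V = 1 := by
      intro V hV
      have hV' : (f V : ℝ) < 1 / 3 := hV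
      show min 1 (max 0 (2 - 3 * (f V : ℝ))) = 1
      exact min_eq_left (le_max_of_le_right (by linarith))
    have hU₁D : U₁ ⊆ D := by
      intro V hV
      by_contra hVD
      have h := hφD V hVD
      rw [hφU₁ V hV] at h
      exact one_ne_zero h
    have hcm := measurable_cutoff (ρ := ρ) (φ := φ) hρm hK₀ hφc
    have hc0 : ∀ W, 0 ≤ K₀.indicator ρ W * φ ((avOfRecord F N K k).avg W) := cutoff_nonneg hρ0 hφ0
    have hcC : ∃ C : ℝ, ∀ W, K₀.indicator ρ W * φ ((avOfRecord F N K k).avg W) ≤ C := ⟨max C₀ 0, cutoff_le hρ0 hC₀ hφ1⟩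
    have hcK : ∀ W, W ∉ K₀ → K₀.indicator ρ W * φ ((avOfRecord F N K k).avg W) = 0 := fun W hW => cutoff_eq_zero_of_not_mem hW
    have hcc : ∀ W ∈ K₀, (∀ b : PBond (F.P K) k, (∀ c, centralBond c ≠ b) → dist1 ((crit ((avOfRecord F N K k).avg W) b)⁻¹ * W b) ≠ ε₁) →
        ContinuousAt (fun W : GaugeField (F.P K) k (SU N) => K₀.indicator ρ W * φ ((avOfRecord F N K k).avg W)) W :=
      fun W hW hQ => continuousAt_cutoff hφc hφ0 hφD hρ0 hC₀ hρK hW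
        (continuousAt_avgFun_of_small (P := F.P K) (j := k) W (hsmall W hW)) (fun hWD => hρc W hW hWD hQ)
    have hreg := (regular_of_loopSmall_thresholds crit hk hα24 hαδ hαL hε hcm hc0 hcC hK₀ hcK hK₀α hcc).1 U₁ hU₁o
    have heqOn : ∀ W, (avOfRecord F N K k).avg W ∈ U₁ → K₀.indicator ρ W * φ ((avOfRecord F N K k).avg W) = ρ W := by
      intro W hW
      rw [hφU₁ _ hW, mul_one]
      by_cases hWK : W ∈ K₀
      · rw [indicator_of_mem hWK]
      · rw [indicator_of_notMem hWK]
        by_contra hne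
        exact hWK (interior_subset (hρK W (hU₁D hW) (Ne.symm hne)))
    have hci : Integrable (fun W : GaugeField (F.P K) k (SU N) => K₀.indicator ρ W * φ ((avOfRecord F N K k).avg W))
        (fieldMeasure (F.P K) k (SU N)) :=
      Integrable.of_bound hcm.aestronglyMeasurable (max C₀ 0)
        (Eventually.of_forall fun W => by rw [Real.norm_eq_abs, abs_of_nonneg (hc0 W)]; exact cutoff_le hρ0 hC₀ hφ1 W)
    exact subset_regSetOfRecord_of_eqOn_preimage hk hci hρi hU₁o heqOn hreg.2 hV₀U₁
  exact ⟨hsub, hasContTransportOn_of_subset_regSetOfRecord hsub⟩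

/-! ## §3 The Sel edition (the OFFER `critCfgSelOfRecord`); the bare edition is g6 FILE 1 itself (`crit := critCfgOfRecord ν K k`, by `rfl`) -/

/-- ★★ **THE Sel EDITION: ROAD B LOCALISED FOR DENSITIES CUT AT THE OFFER's (2.9) THRESHOLDS** (`crit := critCfgSelOfRecord ν K k = M^k ∘ UkSel`, exemption read through
`Node00.fluctDevSelOfRecord`): for these the continuity clause's `hcrit` — continuity of `critCfgSelOfRecord ν K k` on `domAlt_{k+1}` — IS dag-n09-w1 g6's theorem
`hcritSel_domAlt_of_thm1_εbg_of_reg8` from [B11] Thm 1's two-radii binders.  The Sel objects are node00-def-K0c∕dag-n09-w4 g2's OFFER; no record reads them yet.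
[cite: Balaban1987RG1, (2.3) p.265, (2.9) p.266, (2.10) p.267 and p.259; Balaban1985Variational, Thm 1 p.279] -/
theorem regularOn_of_loopSmall_chi29Sel_local (ν : Stage7Numerics) (hk : k < K) {α : ℝ} (hα24 : α ≤ 1 / 24) (hαδ : α < deltaSU (Fin N))
    (hαL : 157 * α < (((F.P K).L : ℝ) ^ ((F.P K).d - 1))⁻¹) {ε₁ : ℝ} (hε : ε₁ ≠ 0) {ρ : Density (F.P K) k (SU N)}
    (hρm : Measurable ρ) (hρi : Integrable ρ (fieldMeasure (F.P K) k (SU N))) (hρ0 : ∀ U, 0 ≤ ρ U)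
    {D : Set (GaugeField (F.P K) (k + 1) (SU N))} (hD : IsOpen D)
    {K₀ : Set (GaugeField (F.P K) k (SU N))} (hK₀ : IsClosed K₀) (hK₀α : ∀ U ∈ K₀, ∀ c i, dist1 (loopHol U c i) ≤ α)
    (hρC : ∃ C₀ : ℝ, ∀ U ∈ K₀, ρ U ≤ C₀)
    (hρK : ∀ U, (avOfRecord F N K k).avg U ∈ D → ρ U ≠ 0 → U ∈ interior K₀)
    (hρc : ∀ U ∈ K₀, (avOfRecord F N K k).avg U ∈ D →
      (∀ b : PBond (F.P K) k, (∀ c, centralBond c ≠ b) → fluctDevSelOfRecord F N ν K k U b ≠ ε₁) → ContinuousAt ρ U) :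
    D ⊆ regSetOfRecord F N K k ρ ∧ HasContTransportOn F N K k ρ D :=
  regularOn_of_loopSmall_thresholds_local (critCfgSelOfRecord F N ν K k) hk hα24 hαδ hαL hε hρm hρi hρ0 hD hK₀ hK₀α hρC hρK
    (fun U hU hUD hQ => hρc U hU hUD fun b hb => by rw [fluctDevSelOfRecord_apply]; exact hQ b hb)

/-- ★ **THE `hreg` SHAPE, Sel EDITION**: `domAltOfRecord F N ν' K (k+1) ⊆ regSetOfRecord F N K k ρ` (and the on-domain proviso) for every `ρ` as in
`regularOn_of_loopSmall_chi29Sel_local` at `D := domAltOfRecord ν' K (k+1)`. [cite: Balaban1987RG1, p.259, (2.9) p.266 and (2.10) p.267] -/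
theorem domAlt_subset_regSetOfRecord_of_loopSmall_chi29Sel_local (ν ν' : Stage7Numerics) (hk : k < K) {α : ℝ} (hα24 : α ≤ 1 / 24)
    (hαδ : α < deltaSU (Fin N)) (hαL : 157 * α < (((F.P K).L : ℝ) ^ ((F.P K).d - 1))⁻¹) {ε₁ : ℝ} (hε : ε₁ ≠ 0)
    {ρ : Density (F.P K) k (SU N)} (hρm : Measurable ρ) (hρi : Integrable ρ (fieldMeasure (F.P K) k (SU N))) (hρ0 : ∀ U, 0 ≤ ρ U)
    {K₀ : Set (GaugeField (F.P K) k (SU N))} (hK₀ : IsClosed K₀) (hK₀α : ∀ U ∈ K₀, ∀ c i, dist1 (loopHol U c i) ≤ α)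
    (hρC : ∃ C₀ : ℝ, ∀ U ∈ K₀, ρ U ≤ C₀)
    (hρK : ∀ U, (avOfRecord F N K k).avg U ∈ domAltOfRecord F N ν' K (k + 1) → ρ U ≠ 0 → U ∈ interior K₀)
    (hρc : ∀ U ∈ K₀, (avOfRecord F N K k).avg U ∈ domAltOfRecord F N ν' K (k + 1) →
      (∀ b : PBond (F.P K) k, (∀ c, centralBond c ≠ b) → fluctDevSelOfRecord F N ν K k U b ≠ ε₁) → ContinuousAt ρ U) :
    domAltOfRecord F N ν' K (k + 1) ⊆ regSetOfRecord F N K k ρ ∧ HasContTransportOn F N K k ρ (domAltOfRecord F N ν' K (k + 1)) :=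
  regularOn_of_loopSmall_chi29Sel_local ν hk hα24 hαδ hαL hε hρm hρi hρ0 (B12ContinuousTransportInvarianceOn.isOpen_domAltOfRecord ν' K (k + 1))
    hK₀ hK₀α hρC hρK hρc

end Summit.QuantumFields.YangMills.BalabanUVNodes.N09RegularOnOfLoopSmallThresholdsAnyCrit

end
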